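import Literature.NumberTheory.LFunctions.Zhang2022.Section8FrontEnd44ReductionRel
import Literature.NumberTheory.LFunctions.Zhang2022.Section9SharpApplications
import Literature.NumberTheory.LFunctions.Zhang2022.Section9FrontEndExact
import HarnessLib

/-!
# Zhang (2022) §9 p. 51: inputs of the gathering step (G9) of `Z22:§9.u004` at the scale `P₃`

Y. Zhang, *Discrete mean estimates and the Landau–Siegel zero*, arXiv:2211.02515v1 (2022)
[Zhang2022LandauSiegel] — **an unrefereed manuscript under adjudication; nothing here asserts anything
about its Theorems 1–2 or about Landau–Siegel zeros.** ZHANG-L discharge lane (WP09), leaf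
`Section9Statements.Step9u004r c′` (hypothesis `h9u004r` of `Skeleton.theorem1_of_leaves_v19`).

`Section9PartialSummation.step9u004r_of_gathering9` reduced the leaf to the "gathering" estimate (G9) —
the §9 twin of `Z22:§8.u044` ("in a way similar to the proof of (8.12)", tex L2613): insert the main
terms of Lemmas 8.2/8.4 into the exact identity `Section9FrontEndExact.Sj_a12_a22_eq` with total error
`o(α)`. The §8 twin is `Section8FrontEnd44ReductionRel` (scales `(P₁, P₂)`, weights `ϰ₁, ϰ₂`); §9 runs
at the scales `(P₂, P₃)` with the weights `ϰ₂, ϰ₃`. This file supplies the `P₃`-level inputs that the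
§8 files provide for `P₁`:

* `params3` — the scale comparisons `log P₃ = 0.498𝓛⁹`, `T ≤ P₃`, `P₃T ≤ P₂`, `P₃ ≤ PT⁻²`, `P₃ < P`
  (`𝓛 ≥ 4`);
* `vk3_mul_eq`, `conj_vk3_mul_eq`, `vk3_mul_eq_zero` — (8.6) for `ϰ₃` at `drm`;
* `norm_M3_le`, `norm_N3_le` — the trivial bounds for the `ϰ₃`-sums on the tail range
  `P₃/T ≤ dr < P₃` (via `Section8FrontEnd44Sizes.norm_msum_tail_le / norm_nsum_tail_le`);
* `u9003R_of_lemma84W` — `Z22:§9.u003` at strength `O(𝓛⁻¹⁵)·W(dr)` from Lemma 8.4 with an error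
  weight `W` (with `W = (∏_{q∣dr}(1−q⁻¹)⁻¹)²` the hypothesis is literally `Skeleton.Lemma84Rel c′`);
  twin of `Section8FrontEnd44ReductionRel.u042R_of_lemma84W`.

Theorem-only; 0 definitions, 0 new facts. WHAT THIS IS NOT: a proof of Lemma 8.2/8.4 or of (G9).

## References

* Y. Zhang, arXiv:2211.02515v1 (2022), §9 p. 51, tex L2598–L2618; §8 (8.6) p. 44, p. 47 tex
  L2420–L2442; §2 (2.21). [cite: Zhang2022LandauSiegel, §9 p.51]
-/

noncomputable section

open Complex Real ComplexConjugate Finset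

namespace Literature.NumberTheory.LFunctions.Zhang2022.Section9Gathering

open Literature.NumberTheory.LFunctions.Zhang2022.Skeleton
open Literature.NumberTheory.LFunctions.Zhang2022.Section8FrontEnd82
open Literature.NumberTheory.LFunctions.Zhang2022.Section8FrontEnd44Sizes

/-! ## Parameters at the scale `P₃` -/

/-- For `D ≥ ⌈e⁴⌉`, `𝓛 = log D ≥ 4`. [cite: Zhang2022LandauSiegel, §2 (2.1) p.4] -/
theorem four_le_ell {D : ℕ} (hD : ⌈Real.exp 4⌉₊ ≤ D) : 4 ≤ ell D := by
  have hexp : Real.exp 4 ≤ D := le_trans (Nat.le_ceil _) (by exact_mod_cast hD)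
  exact (Real.le_log_iff_exp_le (lt_of_lt_of_le (Real.exp_pos _) hexp)).mpr hexp

/-- The scale comparisons for `P₃ = P^{0.498}` once `𝓛 ≥ 4`: `log P₃ = 0.498𝓛⁹`, `𝓛⁹/4 ≤ log P₃`,
`P₃ ≤ PT⁻²`, `T ≤ P₃`, `P₃T ≤ P₂` (i.e. `P₂/P₃ = P^{0.002}T^{−10} ≥ T`), `P₃ < P`.
[cite: Zhang2022LandauSiegel, §2 (2.6), (2.21) p.10] -/
theorem params3 {D : ℕ} (hL : 4 ≤ ell D) :
    Real.log (Skeleton.P3 D) = 0.498 * ell D ^ 9 ∧ ell D ^ 9 / 4 ≤ Real.log (Skeleton.P3 D) ∧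
      Skeleton.P3 D ≤ bigP D / bigT D ^ 2 ∧ bigT D ≤ Skeleton.P3 D ∧
      Skeleton.P3 D * bigT D ≤ Skeleton.P2 D ∧ Skeleton.P3 D < bigP D := by
  set L := ell D with hLdef
  have hL1 : (1 : ℝ) ≤ L := by linarith
  have hL0 : 0 < L := by linarith
  have h11 : L ^ (1.1 : ℝ) ≤ L ^ 2 := by
    rw [← Real.rpow_two]
    exact Real.rpow_le_rpow_of_exponent_le hL1 (by norm_num)
  have h11' : 0 ≤ L ^ (1.1 : ℝ) := by positivity
  have hL7 : (16384 : ℝ) ≤ L ^ 7 := by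
    calc (16384 : ℝ) = 4 ^ 7 := by norm_num
      _ ≤ L ^ 7 := by gcongr
  have hL9 : L ^ 9 = L ^ 2 * L ^ 7 := by ring
  have hL2 : 0 ≤ L ^ 2 := by positivity
  have h2 : 16384 * L ^ 2 ≤ L ^ 9 := by rw [hL9]; nlinarith
  have hP3 : Skeleton.P3 D = Real.exp (0.498 * L ^ 9) := by
    rw [Skeleton.P3, bigP, ← hLdef, ← Real.exp_mul, mul_comm]
  have hT : bigT D = Real.exp (L ^ (1.1 : ℝ)) := by rw [bigT, hLdef]
  have hT2 : bigT D ^ 2 = Real.exp (2 * L ^ (1.1 : ℝ)) := by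
    rw [hT, ← Real.exp_nat_mul]; norm_num
  have hP2 : Skeleton.P2 D = Real.exp (0.5 * L ^ 9 - 10 * L ^ (1.1 : ℝ)) := by
    rw [Skeleton.P2, bigP, ← hLdef, ← Real.exp_mul, hT, ← Real.exp_nat_mul, ← Real.exp_sub]
    norm_num [mul_comm]
  have hP : bigP D = Real.exp (L ^ 9) := by rw [bigP, hLdef]
  refine ⟨?_, ?_, ?_, ?_, ?_, ?_⟩
  · rw [hP3, Real.log_exp]
  · rw [hP3, Real.log_exp]; nlinarith
  · rw [hP3, hP, hT2, ← Real.exp_sub, Real.exp_le_exp]; nlinarith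
  · rw [hT, hP3, Real.exp_le_exp]; nlinarith
  · rw [hP3, hT, hP2, ← Real.exp_add, Real.exp_le_exp]; nlinarith
  · rw [hP3, hP, Real.exp_lt_exp]; nlinarith

/-! ## (8.6) at `drm` for `ϰ₃` -/

/-- `ϰ₃(km) = (log P₃)⁻¹ (x/m)^{β₆} log(x/m)` for `x = P₃/k`, `m < x` (`k, m ≥ 1`), from (8.6).
[cite: Zhang2022LandauSiegel, §8 (8.6) p.44] -/
theorem vk3_mul_eq {D : ℕ} (hP3 : 1 < Skeleton.P3 D) {k m : ℕ} (hk : 1 ≤ k) (hm : 1 ≤ m)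
    (hmx : ((k * m : ℕ) : ℝ) < Skeleton.P3 D) :
    vk3 D (k * m) =
      ((Real.log (Skeleton.P3 D / k / m) : ℝ) : ℂ) / (Real.log (Skeleton.P3 D) : ℂ) *
        (((Skeleton.P3 D / k / m : ℝ) : ℂ)) ^ beta6 D := by
  have hk0 : (0 : ℝ) < k := by exact_mod_cast hk
  have hm0 : (0 : ℝ) < m := by exact_mod_cast hm
  have hP0 : 0 < Skeleton.P3 D := by linarith
  have hlogP : Real.log (Skeleton.P3 D) ≠ 0 := (Real.log_pos hP3).ne'
  have hkm : ((k * m : ℕ) : ℝ) = (k : ℝ) * m := by push_cast; ring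
  rw [vk3, if_pos hmx]
  have h1 : Skeleton.P3 D / ((k * m : ℕ) : ℝ) = Skeleton.P3 D / k / m := by rw [hkm, div_div]
  have h2 : (1 - Real.log ((k * m : ℕ) : ℝ) / Real.log (Skeleton.P3 D)) =
      Real.log (Skeleton.P3 D / k / m) / Real.log (Skeleton.P3 D) := by
    rw [div_div, Real.log_div hP0.ne' (by positivity), hkm]
    field_simp
  rw [h1, h2]
  push_cast
  ring

/-- For a positive real base, `conj (t^β) = t^{conj β}`. [folklore] -/
private theorem conj_ofReal_cpow {t : ℝ} (ht : 0 < t) (β : ℂ) :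
    conj (((t : ℝ) : ℂ) ^ β) = ((t : ℝ) : ℂ) ^ conj β := by
  have harg : ((t : ℝ) : ℂ).arg ≠ π := by
    rw [Complex.arg_ofReal_of_nonneg ht.le]; exact Real.pi_ne_zero.symm
  have h := Complex.conj_cpow ((t : ℝ) : ℂ) (conj β) harg
  rw [Complex.conj_conj, Complex.conj_ofReal] at h
  exact h.symm

/-- `conj ϰ₃(km) = (log P₃)⁻¹ (x/m)^{−β₆} log(x/m)` for `x = P₃/k`, `m < x` ((8.6), `β̄₆ = −β₆`).
[cite: Zhang2022LandauSiegel, §8 (8.6) p.44] -/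
theorem conj_vk3_mul_eq {D : ℕ} (hP3 : 1 < Skeleton.P3 D) {k m : ℕ} (hk : 1 ≤ k) (hm : 1 ≤ m)
    (hmx : ((k * m : ℕ) : ℝ) < Skeleton.P3 D) :
    conj (vk3 D (k * m)) =
      ((Real.log (Skeleton.P3 D / k / m) : ℝ) : ℂ) / (Real.log (Skeleton.P3 D) : ℂ) *
        (((Skeleton.P3 D / k / m : ℝ) : ℂ)) ^ (-beta6 D) := by
  have hk0 : (0 : ℝ) < k := by exact_mod_cast hk
  have hm0 : (0 : ℝ) < m := by exact_mod_cast hm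
  have hP0 : 0 < Skeleton.P3 D := by linarith
  have ht : 0 < Skeleton.P3 D / k / m := by positivity
  rw [vk3_mul_eq hP3 hk hm hmx, map_mul, map_div₀, Complex.conj_ofReal, Complex.conj_ofReal,
    conj_ofReal_cpow ht, Typed.Sec12B.conj_beta6]

/-- `ϰ₃(km) = 0` for `km ≥ P₃` ((8.6)). [cite: Zhang2022LandauSiegel, §8 (8.6) p.44] -/
theorem vk3_mul_eq_zero {D k m : ℕ} (h : Skeleton.P3 D ≤ ((k * m : ℕ) : ℝ)) : vk3 D (k * m) = 0 := by
  rw [vk3, if_neg (not_lt.mpr h)]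

/-! ## The `ϰ₃`-sums on the tail range `P₃/T ≤ dr < P₃`: trivial bounds -/

/-- Trivial bound for the `m`-sum `M₃` of `S_j(𝐚₁₂,𝐚₂₂)` at `dr = k < P₃` (`𝓛 ≥ 4`):
`|M₃| ≤ (log x/log P₃)(1 + log x)`, `x = P₃/k` ((8.6)). [cite: Zhang2022LandauSiegel, §8 (8.6) p.44; §9 p.51] -/
theorem norm_M3_le (c' : ℝ) {D : ℕ} [NeZero D] (χ : DirichletCharacter ℂ D) (hL : 4 ≤ ell D)
    (j : ℕ) {k : ℕ} (hk : 1 ≤ k) (hkP : (k : ℝ) < Skeleton.P3 D) :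
    ‖∑ m ∈ Finset.Ico 1 (Nsupp D), χ (m : ZMod D) * vk3 D (k * m) / (m : ℂ) ^ (1 - betaJ c' D j)‖ ≤
      Real.log (Skeleton.P3 D / k) / Real.log (Skeleton.P3 D) * (1 + Real.log (Skeleton.P3 D / k)) := by
  obtain ⟨-, -, hP3PT, -, -, -⟩ := params3 hL
  have hk1 : (1 : ℝ) ≤ k := by exact_mod_cast hk
  have hk0 : (0 : ℝ) < k := by linarith
  have hP3one : 1 < Skeleton.P3 D := lt_of_le_of_lt hk1 hkP
  have hP3pos : 0 < Skeleton.P3 D := by linarith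
  have hα : 0 ≤ alpha D := by rw [Section2.alpha_eq_pi_div_ell9]; positivity
  have hβ : (beta6 D).re = 0 := (Section8FrontEnd44Reduction.beta6_re_beta7_re hα).1
  have hs : (1 - betaJ c' D j).re = 1 := XiZeroMajorant.one_sub_betaJ_re c' D j
  have hN : ⌈Skeleton.P3 D / k⌉₊ ≤ Nsupp D := by
    show ⌈Skeleton.P3 D / k⌉₊ ≤ ⌈bigP D / bigT D ^ 2⌉₊
    exact Nat.ceil_mono (le_trans (div_le_self hP3pos.le hk1) hP3PT)
  have hx1 : 1 ≤ Skeleton.P3 D / k := (one_le_div hk0).mpr hkP.le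
  exact norm_msum_tail_le χ (V := vk3 D) hP3one hk hβ hs
    (fun m hm hkm => vk3_mul_eq hP3one hk hm hkm) (fun m h => vk3_mul_eq_zero h) hN hx1

/-- Trivial bound for the `n`-sum `N₃` of `S_j(𝐚₁₂,𝐚₂₂)` at `dr = k < P₃` (`𝓛 ≥ 4`):
`|N₃| ≤ (log x/log P₃)·Σ_{n<x}|ξ₀ⱼ(n;d,r)|/n`, `x = P₃/k` ((8.6), `|(x/n)^{−β₆}| = 1`).
[cite: Zhang2022LandauSiegel, §8 (8.6) p.44; §9 p.51] -/
theorem norm_N3_le (c' : ℝ) {D : ℕ} [NeZero D] (χ : DirichletCharacter ℂ D) (hL : 4 ≤ ell D)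
    (j d r : ℕ) {k : ℕ} (hk : 1 ≤ k) (hkP : (k : ℝ) < Skeleton.P3 D) :
    ‖∑ n ∈ Finset.Ico 1 (Nsupp D),
        χ (n : ZMod D) * conj (vk3 D (k * n)) * xiZero c' D j n d r / (n : ℂ)‖ ≤
      Real.log (Skeleton.P3 D / k) / Real.log (Skeleton.P3 D) *
        ∑ n ∈ Finset.Ico 1 ⌈Skeleton.P3 D / k⌉₊, ‖xiZero c' D j n d r‖ / n := by
  obtain ⟨-, -, hP3PT, -, -, -⟩ := params3 hL
  have hk1 : (1 : ℝ) ≤ k := by exact_mod_cast hk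
  have hk0 : (0 : ℝ) < k := by linarith
  have hP3one : 1 < Skeleton.P3 D := lt_of_le_of_lt hk1 hkP
  have hP3pos : 0 < Skeleton.P3 D := by linarith
  have hα : 0 ≤ alpha D := by rw [Section2.alpha_eq_pi_div_ell9]; positivity
  have hβ : (-beta6 D).re = 0 := by
    rw [Complex.neg_re, (Section8FrontEnd44Reduction.beta6_re_beta7_re hα).1, neg_zero]
  have hN : ⌈Skeleton.P3 D / k⌉₊ ≤ Nsupp D := by
    show ⌈Skeleton.P3 D / k⌉₊ ≤ ⌈bigP D / bigT D ^ 2⌉₊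
    exact Nat.ceil_mono (le_trans (div_le_self hP3pos.le hk1) hP3PT)
  have hx1 : 1 ≤ Skeleton.P3 D / k := (one_le_div hk0).mpr hkP.le
  exact norm_nsum_tail_le χ (W := fun i => conj (vk3 D i)) (fun n => xiZero c' D j n d r)
    hP3one hk hβ (fun n hn hkn => conj_vk3_mul_eq hP3one hk hn hkn)
    (fun n h => by simp only [vk3_mul_eq_zero h, map_zero]) hN hx1

/-! ## `Z22:§9.u003` with an error weight, from Lemma 8.4 with the same weight -/

/-- **`Z22:§9.u003` with an error weight `W(dr)` ⇐ Lemma 8.4 with the same weight** (`W ≥ 0`):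
`Σ_n χ(n)ϰ̄₃(drn)ξ₀ⱼ(n;d,r)/n = (L′(1,χ)Π(d,r)/log P₃)𝔤_{j6}(P₃/dr) + O(𝓛⁻¹⁵·W(dr))` for `dr < P₃/T`
(`μ = 6`, `y = P₃/dr`, (8.6), `β̄₆ = −β₆`, `log P₃ = 0.498𝓛⁹`; constant `3|C|`). With
`W(n) = (∏_{q∣n}(1−q⁻¹)⁻¹)²` the hypothesis is literally `Skeleton.Lemma84Rel c′`; twin of
`Section8FrontEnd44ReductionRel.u042R_of_lemma84W`. [cite: Zhang2022LandauSiegel, §9 p.51, tex L2609–L2612] -/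
theorem u9003R_of_lemma84W (c' : ℝ) {W : ℕ → ℝ} (hW : ∀ n, 0 ≤ W n)
    (h84 : ∃ C : ℝ, ForAllLarge fun D _ χ => AssumptionA D χ →
      ∀ j ∈ ({1, 2, 3} : Finset ℕ), ∀ μ ∈ ({6, 7} : Finset ℕ), ∀ d r : ℕ, 1 ≤ d → 1 ≤ r →
        ((d * r : ℕ) : ℝ) < bigP D / bigT D ^ 2 → ∀ y : ℝ, bigT D < y → y < bigP D →
          ‖(∑ n ∈ Finset.Ico 1 ⌈y⌉₊, χ (n : ZMod D) * xiZero c' D j n d r / (n : ℂ) *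
                ((y / n : ℝ) : ℂ) ^ (-betaMu D μ) * (Real.log (y / n) : ℂ)) -
              deriv χ.LFunction 1 * PiW χ d r * frakgW c' D j μ y‖ ≤
            C * (ell D ^ 6)⁻¹ * W (d * r)) :
    ∃ C : ℝ, ForAllLarge fun D _ χ => AssumptionA D χ →
      ∀ j ∈ ({1, 2, 3} : Finset ℕ), ∀ d r : ℕ, 1 ≤ d → 1 ≤ r →
        ((d * r : ℕ) : ℝ) < Skeleton.P3 D / bigT D →
          ‖(∑ n ∈ Finset.Ico 1 (Nsupp D),
                χ (n : ZMod D) * conj (vk3 D (d * r * n)) * xiZero c' D j n d r / (n : ℂ)) -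
              deriv χ.LFunction 1 * PiW χ d r / (Real.log (Skeleton.P3 D) : ℂ) *
                frakgW c' D j 6 (Skeleton.P3 D / ((d * r : ℕ) : ℝ))‖ ≤
            C * (ell D ^ 15)⁻¹ * W (d * r) := by
  obtain ⟨C, D₀, h⟩ := h84
  refine ⟨3 * |C|, max D₀ ⌈Real.exp 4⌉₊, fun D _ χ hD hq hp hA j hj d r hd hr hdr => ?_⟩
  have hD₀ : D₀ ≤ D := le_trans (le_max_left _ _) hD
  have hL : 4 ≤ ell D := four_le_ell (le_trans (le_max_right _ _) hD)
  obtain ⟨hlogP3, -, hP3PT, hTP3, -, hP3P⟩ := params3 hL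
  have hL0 : 0 < ell D := by linarith
  have hT0 : 0 < bigT D := Real.exp_pos _
  have hdr1 : 1 ≤ d * r := Nat.one_le_iff_ne_zero.mpr (Nat.mul_ne_zero (by omega) (by omega))
  have hdr0 : (0 : ℝ) < ((d * r : ℕ) : ℝ) := by exact_mod_cast hdr1
  set x : ℝ := Skeleton.P3 D / ((d * r : ℕ) : ℝ) with hx
  have hP3x : Skeleton.P3 D = ((d * r : ℕ) : ℝ) * x := by rw [hx]; field_simp
  have hxT : bigT D < x := by
    rw [hx, lt_div_iff₀ hdr0]; rw [lt_div_iff₀ hT0] at hdr; linarith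
  have hP3pos : 0 < Skeleton.P3 D := Real.rpow_pos_of_pos (Real.exp_pos _) _
  have hxle : x ≤ Skeleton.P3 D := div_le_self hP3pos.le (by exact_mod_cast hdr1)
  have hxP : x < bigP D := lt_of_le_of_lt hxle hP3P
  have hT1 : 1 < bigT D := by
    rw [bigT]; exact Real.one_lt_exp_iff.mpr (by positivity)
  have hP3one : 1 < Skeleton.P3 D := lt_of_lt_of_le (lt_trans hT1 hxT) hxle
  have hdrPT : ((d * r : ℕ) : ℝ) < bigP D / bigT D ^ 2 :=
    lt_of_lt_of_le hdr ((div_le_self hP3pos.le hT1.le).trans hP3PT)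
  have key := h D χ hD₀ hq hp hA j hj 6 (by simp) d r hd hr hdrPT x hxT hxP
  have hWdr : 0 ≤ W (d * r) := hW _
  have key' : ‖(∑ n ∈ Finset.Ico 1 ⌈x⌉₊, χ (n : ZMod D) * xiZero c' D j n d r / (n : ℂ) *
        ((x / n : ℝ) : ℂ) ^ (-betaMu D 6) * (Real.log (x / n) : ℂ)) -
          deriv χ.LFunction 1 * PiW χ d r * frakgW c' D j 6 x‖ ≤
      |C| * (ell D ^ 6)⁻¹ * W (d * r) := by
    refine key.trans ?_
    have hℓ : 0 ≤ (ell D ^ 6)⁻¹ := by positivity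
    gcongr
    exact le_abs_self _
  have hsub : Finset.Ico 1 ⌈x⌉₊ ⊆ Finset.Ico 1 (Nsupp D) := Ico_ceil_subset hP3PT hdr1
  have hsum : (∑ n ∈ Finset.Ico 1 (Nsupp D),
        χ (n : ZMod D) * conj (vk3 D (d * r * n)) * xiZero c' D j n d r / (n : ℂ)) =
      (1 / (Real.log (Skeleton.P3 D) : ℂ)) *
        ∑ n ∈ Finset.Ico 1 ⌈x⌉₊, χ (n : ZMod D) * xiZero c' D j n d r / (n : ℂ) *
          ((x / n : ℝ) : ℂ) ^ (-betaMu D 6) * (Real.log (x / n) : ℂ) := by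
    rw [Finset.mul_sum]
    symm
    apply Finset.sum_subset_zero_on_sdiff hsub
    · intro n hn
      rw [Finset.mem_sdiff, Finset.mem_Ico, Finset.mem_Ico, not_and, not_lt] at hn
      have hxn : x ≤ n := Nat.ceil_le.mp (hn.2 hn.1.1)
      have : Skeleton.P3 D ≤ ((d * r * n : ℕ) : ℝ) := by
        rw [hP3x]; push_cast
        exact mul_le_mul_of_nonneg_left hxn (by positivity)
      rw [vk3_mul_eq_zero this, map_zero, mul_zero, zero_mul, zero_div]
    · intro n hn
      rw [Finset.mem_Ico] at hn
      have hn1 : 1 ≤ n := hn.1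
      have hnx : (n : ℝ) < x := Nat.lt_ceil.mp hn.2
      have hn0 : (0 : ℝ) < n := by exact_mod_cast hn1
      have hdrn : ((d * r * n : ℕ) : ℝ) < Skeleton.P3 D := by
        rw [hP3x]; push_cast
        have := mul_lt_mul_of_pos_left hnx hdr0
        push_cast at this; linarith
      rw [conj_vk3_mul_eq hP3one hdr1 hn1 hdrn]
      have hb : betaMu D 6 = beta6 D := by simp [betaMu]
      rw [hb, show Skeleton.P3 D / ((d * r : ℕ) : ℝ) / n = x / n by rw [hx]]
      ring
  have hlog0 : 0 < Real.log (Skeleton.P3 D) := by rw [hlogP3]; positivity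
  rw [hsum, show (1 / (Real.log (Skeleton.P3 D) : ℂ)) *
        (∑ n ∈ Finset.Ico 1 ⌈x⌉₊, χ (n : ZMod D) * xiZero c' D j n d r / (n : ℂ) *
          ((x / n : ℝ) : ℂ) ^ (-betaMu D 6) * (Real.log (x / n) : ℂ)) -
        deriv χ.LFunction 1 * PiW χ d r / (Real.log (Skeleton.P3 D) : ℂ) * frakgW c' D j 6 x =
      (1 / (Real.log (Skeleton.P3 D) : ℂ)) *
        ((∑ n ∈ Finset.Ico 1 ⌈x⌉₊, χ (n : ZMod D) * xiZero c' D j n d r / (n : ℂ) *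
          ((x / n : ℝ) : ℂ) ^ (-betaMu D 6) * (Real.log (x / n) : ℂ)) -
          deriv χ.LFunction 1 * PiW χ d r * frakgW c' D j 6 x) by ring, norm_mul]
  have hn : ‖(1 / (Real.log (Skeleton.P3 D) : ℂ))‖ = 1 / Real.log (Skeleton.P3 D) := by
    rw [norm_div, norm_one, Complex.norm_real, Real.norm_eq_abs, abs_of_pos hlog0]
  rw [hn]
  have hC0 : 0 ≤ |C| := abs_nonneg _
  calc 1 / Real.log (Skeleton.P3 D) * ‖(∑ n ∈ Finset.Ico 1 ⌈x⌉₊,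
          χ (n : ZMod D) * xiZero c' D j n d r / (n : ℂ) * ((x / n : ℝ) : ℂ) ^ (-betaMu D 6) *
            (Real.log (x / n) : ℂ)) - deriv χ.LFunction 1 * PiW χ d r * frakgW c' D j 6 x‖
      ≤ 1 / Real.log (Skeleton.P3 D) * (|C| * (ell D ^ 6)⁻¹ * W (d * r)) :=
        mul_le_mul_of_nonneg_left key' (by positivity)
    _ = |C| / 0.498 * (ell D ^ 15)⁻¹ * W (d * r) := by rw [hlogP3]; field_simp
    _ ≤ 3 * |C| * (ell D ^ 15)⁻¹ * W (d * r) := by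
        apply mul_le_mul_of_nonneg_right _ hWdr
        apply mul_le_mul_of_nonneg_right _ (by positivity)
        rw [div_le_iff₀ (by norm_num)]; nlinarith

end Literature.NumberTheory.LFunctions.Zhang2022.Section9Gathering
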